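import Summits.HodgeConjecture.HodgeConjecture.Theorems.F0P3cDyRamFourFrameSocketDefs   -- ★ DEFS LEAF №2a «SOCKET» (p854576): `RankTransferWild` + the organ's ★ vocabulary (leaf imports: `localTransferAtOne_of_germExpansion`, `exists_forall_classOrbitalIntegral_eq_sum_mul_of_det_ne_zero`, `antidiagOne_isHermitian`, `isUnit_antidiagOne_det`)
import HarnessLib

/-!
# Crux `H413`, line LH4 «(D-RAM) FOUR-FRAME» road, STAGE 1a — THE TOP JOINT (cert of record v1.1, ★-grade): `RankTransferWild M → ‹organ (D-RAM) stub_DyRamCore›`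
# (★ tree twin of `F0/P3a/F0P3a-p01/g30/SOCKETCERT-DRAM-FourFrame.v1_1.F0P3ap01g30.lean` 94d1d696bbaaed50 `dyRamCore_of_fourFrame` l. 94–132; deal g10-#14 «CERT PORT»)

Cell `hodgecm-mathlib` (D-0151), FLOOR 0, crux item H413 = `stmt-HodgeConjecture-24833`, route of record `HCCMUnconditional`; squad F0∕P3c∕LH4 (req618), dealer LH4-plan
(g10) WORD #7 (DESIGN WORD v1) §A deal g10-#14; heir LEAD F0P3a-plan DIRECTIVE D1 «top joint = the socket cert of record v1.1»; author of the HOME proof F0P3a-p01 (g30) (six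
independent re-checks, `rfl` BY NAME against the served leaf ED. 4 0265c8a902d133c3 in the cert's f4 leg), port LH4-p03 (g11).  THEOREMS ONLY (one theorem; no `def`, no
instance, no notation, no `sorry`, default heartbeats, no `set_option`); imports = ★ DEFS LEAF №2a `Theorems/F0P3cDyRamFourFrameSocketDefs.lean` (p854576: `RankTransferWild`
BY NAME, + the organ's ★ vocabulary through its leaf imports) + HarnessLib; lane `--supports stmt-HodgeConjecture-24833 --as helper` (count-neutral).

WHAT IS PROVED.  `dyRamCore_of_rankTransferWild (M) (h : RankTransferWild M) : ‹the statement of organ (D-RAM) `stub_DyRamCore` of the leaf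
`Cruxes/H413/Lines/F0_P3c_DyadicPaydown.lean` ED. 4 :147, TOKEN FOR TOKEN›` — for every CM field `L`, unitary Hecke character `μ` restricting to `ω_{L∕L⁺}`, every finite place `v`
of `L⁺` NON-SPLIT and RAMIFIED in `L` (`e(w|v) ≠ 1`) and WILD (`2 ∉ 𝒪_w^×`), given canonical orbital-measure families on `H(L⁺_v) = U(Φ₂) × U(Φ₁)` and `G(L⁺_v) = U(Φ₃)` and
the Shalika germ expansion for `U(Φ₃)(L⁺_v)`, every locally constant compactly supported `φ₃` has a `Δ‴_v[μ]`-transfer `φH` near `1`.  A `Theorems/` file cannot import the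
`Lines/` leaf, so the organ is SPELLED OUT here (the cert's bytes); the line file's sorry-free §2 `DyRamCore_of` applies this theorem and Lean reads the organ BY NAME there
(TYPE digit 4239658620).  PROOF (p01 (g30), carried verbatim): uniformiser `ϖ_w` (Mathlib `valuation_exists_uniformizer`); `(S, mU, Γ, hgerm)` from the organ's own Shalika
hypothesis at `mG₃`; `h` ONCE at `(L, w, hw, he, h2, ϖ_w)` ↦ pieces `gref`, table `htab`, transfers `htr`; ★ `localTransferAtOne_of_germExpansion` with the transfers in the
`htr` slot and ★ `exists_forall_classOrbitalIntegral_eq_sum_mul_of_det_ne_zero S mU gref htab φ₃` in the `hspan` slot; `Φ₃` hermitian with unit determinant (★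
`antidiagOne_isHermitian`, ★ `isUnit_antidiagOne_det`).  With ★ p854606 `rankTransferWild_of_anchorRows` the sorry-free spine of the sibling line
`Cruxes/H413/Lines/F0_P3c_DyRamFourFrame.lean` is `AnchorRowsWild Mstar → RankTransferWild Mstar → organ`, both arrows ★.

HONEST LABEL.  Count-neutral: the antecedent `RankTransferWild M` (reference pieces of `ϖ_w`-adic level `M(w)`, invertible unipotent table, per-piece `Δ‴_v[μ]`-transfer at `1`)
is the road's typing∕proving debt (units (ii)–(iv)); the verdict of record for (D-RAM) stays PRINT [LanglandsShelstad1989 Thm. p. 484 ∕ Rogawski1990 Prop. 4.9.1 (a)] ∕ XL;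
`HC_CM` is proved only modulo the 7 printed citations (2 remaining: hLiu418 = `stmt-HodgeConjecture-24832`, h413 = `stmt-HodgeConjecture-24833`) until rung 0 closes.

## References
* [Rogawski1990] J. D. Rogawski, *Automorphic Representations of Unitary Groups in Three Variables*, Ann. of Math. Stud. 123 (1990): §4.9 Prop. 4.9.1 (a) p. 55; §8.1 Props.
  8.1.1–8.1.2 pp. 112–114 (germ expansions at the identity).
* [LanglandsShelstad1989] R. P. Langlands, D. Shelstad, *Orbital integrals on forms of SL(3), II*, Canad. J. Math. 41 (1989) 480–507: Theorem (end of §2) p. 484.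
* [LanglandsShelstad1990Descent] R. P. Langlands, D. Shelstad, *Descent for transfer factors*, The Grothendieck Festschrift II (1990): §2.1 (2.1.2).
-/

noncomputable section

namespace Summit.HodgeConjecture.HodgeConjecture.Cruxes.H413.F0P3cDyRamCoreOfRankTransferWild

open MeasureTheory Measure NumberField IsDedekindDomain Topology Filter
open Literature.NumberTheory.Automorphic Literature.NumberTheory.Automorphic.UnitaryGroup Literature.NumberTheory.Automorphic.IntegralReduction
open Literature.NumberTheory.Rogawski1990 Literature.NumberTheory.GaloisRepresentations
open Literature.MeasureTheory.Group (descConj)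
open scoped Matrix MatrixGroups Classical ValuativeRel
open Summit.HodgeConjecture.HodgeConjecture.Cruxes.H413.F0P3cDyRamFourFrameSocketDefs

/-- **`dyRamCore_of_rankTransferWild` — THE (D-RAM) SOCKET from the FUSED input `RankTransferWild M` (★ tree twin of cert v1.1 94d1d696bbaaed50 `dyRamCore_of_fourFrame`, token for token).**  Conclusion = the organ `stub_DyRamCore` VERBATIM; hypotheses = the level bound `M` and
`h : RankTransferWild M`.  PROOF (★ by name): uniformiser `ϖ_w` (Mathlib); `(S, mU, Γ, hgerm)` from the organ's own Shalika hypothesis at `mG₃`; `h` ONCE at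
`(L, w, hw, he, h2, ϖ_w)` with `(S, mU)` ↦ pieces `gref`, table `htab`, transfers `htr`; ★ `localTransferAtOne_of_germExpansion` with `htr μ hμu hμω νH νG₃ hmH hmG₃ i` in the
`htr` slot and ★ `exists_forall_classOrbitalIntegral_eq_sum_mul_of_det_ne_zero S mU gref htab φ₃` in the `hspan` slot; `Φ₃` hermitian with unit det (★ `antidiagOne_isHermitian`,
★ `isUnit_antidiagOne_det`). [cite: Rogawski1990, §8.1 Props. 8.1.1–8.1.2 pp. 112–114; §4.9 Prop. 4.9.1 (a) p. 55] [cite: LanglandsShelstad1990Descent, §2.1 (2.1.2)] -/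
theorem dyRamCore_of_rankTransferWild (M : ∀ (L : Type) [Field L] [NumberField L] [IsCMField L] (v : HeightOneSpectrum (𝓞 ↥(maximalRealSubfield L))), UnitaryGroup.PlacesOver L v → ℕ) (h : RankTransferWild M) :
    ∀ (L : Type) [Field L] [NumberField L] [IsCMField L] (μ : HeckeCharacter L)
      {v : HeightOneSpectrum (𝓞 ↥(maximalRealSubfield L))} (w : UnitaryGroup.PlacesOver L v)
      (_hw : IsCMField.complexConj L • w.1 = w.1) (_he : v.asIdeal.ramificationIdx' w.1.asIdeal ≠ 1)
      (_hμu : μ.IsUnitary)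
      (_hμω : ∀ x : ideleGroup ↥(maximalRealSubfield L), μ (AdeleRing.ideleBaseChange ↥(maximalRealSubfield L) L x) = quadraticHeckeCharCM L x)
      (_h2 : ¬ IsUnit (2 : 𝒪[w.1.adicCompletion L]))
      [MeasurableSpace ((UnitaryGroup.cmDatum L 3 (Matrix.of fun i j : Fin 3 => if i.val + j.val + 1 = 3 then (1 : L) else 0)).Local v)] [BorelSpace ((UnitaryGroup.cmDatum L 3 (Matrix.of fun i j : Fin 3 => if i.val + j.val + 1 = 3 then (1 : L) else 0)).Local v)]
      [∀ γ : ((UnitaryGroup.cmDatum L 3 (Matrix.of fun i j : Fin 3 => if i.val + j.val + 1 = 3 then (1 : L) else 0)).Local v), MeasurableSpace (((UnitaryGroup.cmDatum L 3 (Matrix.of fun i j : Fin 3 => if i.val + j.val + 1 = 3 then (1 : L) else 0)).Local v) ⧸ Subgroup.centralizer ({γ} : Set ((UnitaryGroup.cmDatum L 3 (Matrix.of fun i j : Fin 3 => if i.val + j.val + 1 = 3 then (1 : L) else 0)).Local v)))]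
      [∀ γ : ((UnitaryGroup.cmDatum L 3 (Matrix.of fun i j : Fin 3 => if i.val + j.val + 1 = 3 then (1 : L) else 0)).Local v), BorelSpace (((UnitaryGroup.cmDatum L 3 (Matrix.of fun i j : Fin 3 => if i.val + j.val + 1 = 3 then (1 : L) else 0)).Local v) ⧸ Subgroup.centralizer ({γ} : Set ((UnitaryGroup.cmDatum L 3 (Matrix.of fun i j : Fin 3 => if i.val + j.val + 1 = 3 then (1 : L) else 0)).Local v)))]
      [MeasurableSpace ((UnitaryGroup.cmDatum L 2 (Matrix.of fun i j : Fin 2 => if i.val + j.val + 1 = 2 then (1 : L) else 0)).Local v × (UnitaryGroup.cmDatum L 1 (Matrix.of fun i j : Fin 1 => if i.val + j.val + 1 = 1 then (1 : L) else 0)).Local v)] [BorelSpace ((UnitaryGroup.cmDatum L 2 (Matrix.of fun i j : Fin 2 => if i.val + j.val + 1 = 2 then (1 : L) else 0)).Local v × (UnitaryGroup.cmDatum L 1 (Matrix.of fun i j : Fin 1 => if i.val + j.val + 1 = 1 then (1 : L) else 0)).Local v)]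
      [∀ a : ((UnitaryGroup.cmDatum L 2 (Matrix.of fun i j : Fin 2 => if i.val + j.val + 1 = 2 then (1 : L) else 0)).Local v × (UnitaryGroup.cmDatum L 1 (Matrix.of fun i j : Fin 1 => if i.val + j.val + 1 = 1 then (1 : L) else 0)).Local v), MeasurableSpace (((UnitaryGroup.cmDatum L 2 (Matrix.of fun i j : Fin 2 => if i.val + j.val + 1 = 2 then (1 : L) else 0)).Local v × (UnitaryGroup.cmDatum L 1 (Matrix.of fun i j : Fin 1 => if i.val + j.val + 1 = 1 then (1 : L) else 0)).Local v) ⧸ Subgroup.centralizer ({a} : Set ((UnitaryGroup.cmDatum L 2 (Matrix.of fun i j : Fin 2 => if i.val + j.val + 1 = 2 then (1 : L) else 0)).Local v × (UnitaryGroup.cmDatum L 1 (Matrix.of fun i j : Fin 1 => if i.val + j.val + 1 = 1 then (1 : L) else 0)).Local v)))]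
      [∀ a : ((UnitaryGroup.cmDatum L 2 (Matrix.of fun i j : Fin 2 => if i.val + j.val + 1 = 2 then (1 : L) else 0)).Local v × (UnitaryGroup.cmDatum L 1 (Matrix.of fun i j : Fin 1 => if i.val + j.val + 1 = 1 then (1 : L) else 0)).Local v), BorelSpace (((UnitaryGroup.cmDatum L 2 (Matrix.of fun i j : Fin 2 => if i.val + j.val + 1 = 2 then (1 : L) else 0)).Local v × (UnitaryGroup.cmDatum L 1 (Matrix.of fun i j : Fin 1 => if i.val + j.val + 1 = 1 then (1 : L) else 0)).Local v) ⧸ Subgroup.centralizer ({a} : Set ((UnitaryGroup.cmDatum L 2 (Matrix.of fun i j : Fin 2 => if i.val + j.val + 1 = 2 then (1 : L) else 0)).Local v × (UnitaryGroup.cmDatum L 1 (Matrix.of fun i j : Fin 1 => if i.val + j.val + 1 = 1 then (1 : L) else 0)).Local v)))]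
      (νH : Measure ((UnitaryGroup.cmDatum L 2 (Matrix.of fun i j : Fin 2 => if i.val + j.val + 1 = 2 then (1 : L) else 0)).Local v × (UnitaryGroup.cmDatum L 1 (Matrix.of fun i j : Fin 1 => if i.val + j.val + 1 = 1 then (1 : L) else 0)).Local v)) [νH.IsHaarMeasure] [νH.IsMulRightInvariant]
      (νG₃ : Measure ((UnitaryGroup.cmDatum L 3 (Matrix.of fun i j : Fin 3 => if i.val + j.val + 1 = 3 then (1 : L) else 0)).Local v)) [νG₃.IsHaarMeasure] [νG₃.IsMulRightInvariant]
      {mH : OrbitalMeasureFamily ((UnitaryGroup.cmDatum L 2 (Matrix.of fun i j : Fin 2 => if i.val + j.val + 1 = 2 then (1 : L) else 0)).Local v × (UnitaryGroup.cmDatum L 1 (Matrix.of fun i j : Fin 1 => if i.val + j.val + 1 = 1 then (1 : L) else 0)).Local v)} {mG₃ : OrbitalMeasureFamily ((UnitaryGroup.cmDatum L 3 (Matrix.of fun i j : Fin 3 => if i.val + j.val + 1 = 3 then (1 : L) else 0)).Local v)},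
      mH.IsCanonical (IsLocalGRegular L v) νH → mG₃.IsCanonical (fun γ => IsRegularElt (γ.val : GL (Fin 3) (UnitaryGroup.LocalRing L v))) νG₃ →
      ShalikaGermExpansionNonsplit L (Matrix.of fun i j : Fin 3 => if i.val + j.val + 1 = 3 then (1 : L) else 0) v →
      ∀ (φ₃ : ((UnitaryGroup.cmDatum L 3 (Matrix.of fun i j : Fin 3 => if i.val + j.val + 1 = 3 then (1 : L) else 0)).Local v) → ℂ), IsLocSmooth φ₃ →
        ∃ V ∈ 𝓝 (1 : ((UnitaryGroup.cmDatum L 2 (Matrix.of fun i j : Fin 2 => if i.val + j.val + 1 = 2 then (1 : L) else 0)).Local v × (UnitaryGroup.cmDatum L 1 (Matrix.of fun i j : Fin 1 => if i.val + j.val + 1 = 1 then (1 : L) else 0)).Local v)), ∃ φH : ((UnitaryGroup.cmDatum L 2 (Matrix.of fun i j : Fin 2 => if i.val + j.val + 1 = 2 then (1 : L) else 0)).Local v × (UnitaryGroup.cmDatum L 1 (Matrix.of fun i j : Fin 1 => if i.val + j.val + 1 = 1 then (1 : L) else 0)).Local v) → ℂ, IsLocSmooth φH ∧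
          ∀ γH ∈ V, IsLocalGRegular L v γH →
            stableOrbitalIntegralRel (IsLocalStablyConjH L v) mH φH γH =
              ∑ᶠ c : ConjClasses ((UnitaryGroup.cmDatum L 3 (Matrix.of fun i j : Fin 3 => if i.val + j.val + 1 = 3 then (1 : L) else 0)).Local v), ((finExplicitCollection L (Matrix.of fun i j : Fin 3 => if i.val + j.val + 1 = 3 then (1 : L) else 0) μ (finExplicitDelta_conj_left_all L (Matrix.of fun i j : Fin 3 => if i.val + j.val + 1 = 3 then (1 : L) else 0) μ) (finExplicitDelta_conj_right_all L (Matrix.of fun i j : Fin 3 => if i.val + j.val + 1 = 3 then (1 : L) else 0) μ)) v).Δ γH (Quotient.out c) * classOrbitalIntegral mG₃ φ₃ c := by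
  intro L _ _ _ μ v w hw he hμu hμω h2 _ _ _ _ _ _ _ _ νH _ _ νG₃ _ _ mH mG₃ hmH hmG₃ hSh φ₃ hφ₃
  -- (0) a uniformiser of `L_w` (the level token of the input is `ϖ_w`-adic; its choice is immaterial)
  obtain ⟨π, hπ⟩ := w.1.valuation_exists_uniformizer L
  have hϖ : Valued.v (π : w.1.adicCompletion L) = WithZero.exp (-1 : ℤ) := by
    rw [HeightOneSpectrum.valuedAdicCompletion_eq_valuation', hπ]
  -- (1) ROUTE (A): the germ datum at `v` for the canonical family `mG₃`, from the organ's own Shalika hypothesis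
  obtain ⟨S, mU, Γ, hS, hmU, hRao, hgerm⟩ := hSh mG₃ hmG₃.isAdmissibleOn
  -- (2) the fused input ONCE at the organ's place datum: pieces, table, transfers
  obtain ⟨gref, hgs, hgK, hginv, hgM, htab, htr⟩ := h L w hw he h2 (π : w.1.adicCompletion L) hϖ S hS mU hmU hRao
  -- (3) the ★ germ fold
  exact localTransferAtOne_of_germExpansion L (Matrix.of fun i j : Fin 3 => if i.val + j.val + 1 = 3 then (1 : L) else 0) v
    (UnitaryGroup.antidiagOne_isHermitian L 3) (UnitaryGroup.isUnit_antidiagOne_det L 3).ne_zero hmH.isAdmissibleOn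
    ((finExplicitCollection L (Matrix.of fun i j : Fin 3 => if i.val + j.val + 1 = 3 then (1 : L) else 0) μ (finExplicitDelta_conj_left_all L (Matrix.of fun i j : Fin 3 => if i.val + j.val + 1 = 3 then (1 : L) else 0) μ) (finExplicitDelta_conj_right_all L (Matrix.of fun i j : Fin 3 => if i.val + j.val + 1 = 3 then (1 : L) else 0) μ)) v)
    mG₃ S mU Γ hgerm gref hgs
    (fun i => htr μ hμu hμω νH νG₃ hmH hmG₃ i) φ₃ hφ₃
    (exists_forall_classOrbitalIntegral_eq_sum_mul_of_det_ne_zero S mU gref htab φ₃)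

end Summit.HodgeConjecture.HodgeConjecture.Cruxes.H413.F0P3cDyRamCoreOfRankTransferWild

end
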